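import Summits.CriticalPhenomena.CardyFormulaZ2.Theorems.CardyMagicRigidityNestingRigidityZPinchLocality
import HarnessLib

/-!
# Crux `NestingRigidity`, line `pinch-resampling` (v2), stub S3: the range of the pinch event on `ℤ²`

Crux `Summit.CriticalPhenomena.CardyFormulaZ2.Theses.CardyMagicRigidity.NestingRigidity`
(stmt-CriticalPhenomena-4835), line `pinch-resampling` v2, vocabulary `CardyMagicRigidityPinchResamplingDefs`,
stub S3 `stub_fourArmCouplingZ2` (and the locality bookkeeping of S4 `stub_tomographicTransfer`, step (ii):
"far-apart neck regions are conditionally independent").  Sequel of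
`CardyMagicRigidityNestingRigidityZPinchLocality` (determining pair set of `ZPinch`): here the OUTWARD
locality of the pinch event.

* `zIntEdges_eq_sym2`, `zExtEdges_eq_sym2` — the interior / exterior pair sets of the vocabulary are Mathlib's
  `Set.sym2` of the box / of its complement.
* `mem_zBall_succ_of_mem_dualEdge` — if the dual pair `dualEdge e` has all its (lower-left-corner) indices in
  the dual box `zDualBall x n` (radius `n + ½`), then the pair `e` lies inside the primal box `Λ_{n+1}(x)`.
* `zPinch_determinedBy_zIntEdges` (registered anchor) — **`ZPinch x y m n` is determined by the pairs inside
  `Λ_{2n+1}(x)`**; `zHook_determinedBy_zIntEdges` — `ZHook x y m n` by the pairs inside `Λ_{2n}(x)`.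
* `disjoint_zIntEdges` — disjoint boxes have disjoint interior pair sets; hence
  `real_zPinch_inter_zPinch` — **pinch events (cut down by any local events of their boxes) in disjoint boxes
  `Λ_{2n+1}(x)`, `Λ_{2n'+1}(x')` are independent** under `P_{1/2}` (product measure,
  `bondPercolation_real_inter_of_disjoint`).
-/

noncomputable section

namespace Summit.CriticalPhenomena.CardyFormulaZ2.Cruxes.NestingRigidity.PinchResampling

open MeasureTheory Literature.Probability.Percolation Literature.Probability.LatticeModels

/-- The interior pairs of `Λ_s(y)` are the unordered pairs inside the box (`Set.sym2`). -/
theorem zIntEdges_eq_sym2 (y : Site 2) (s : ℕ) : zIntEdges y s = (zBall y s).sym2 := by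
  ext e
  rw [Set.mem_sym2_iff_subset]
  rfl

/-- The exterior pairs of `Λ_n(x)` are the unordered pairs inside the complement of the box. -/
theorem zExtEdges_eq_sym2 (x : Site 2) (n : ℕ) : zExtEdges x n = ((zBall x n)ᶜ).sym2 := by
  ext e
  rw [Set.mem_sym2_iff_subset]
  rfl

/-- The dual box of radius `n + ½` about `x` lies inside the primal box `Λ_{n+1}(x)` (as index sets). -/
theorem zDualBall_subset_zBall_succ (x : Site 2) (n : ℕ) : zDualBall x n ⊆ zBall x (n + 1) := by
  intro v hv
  rw [mem_zDualBall_iff] at hv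
  rw [mem_zBall_iff]
  simp only [abs_le, Nat.cast_add, Nat.cast_one] at hv ⊢
  omega

/-- **A pair whose dual pair lies in the dual box of radius `n + ½` lies in `Λ_{n+1}(x)`.**  For a lattice
edge `{u, u + eᵢ}` the dual pair is `{u - e_{1-i}, u}` (`dualEdge_horizontal`, `dualEdge_vertical`), so `u` is
a dual index in the box and `u + eᵢ` is one step further; off the edge set `dualEdge` is the identity. -/
theorem mem_zBall_succ_of_mem_dualEdge {x : Site 2} {n : ℕ} {e : Sym2 (Site 2)}
    (he : ∀ u ∈ dualEdge e, u ∈ zDualBall x n) : ∀ v ∈ e, v ∈ zBall x (n + 1) := by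
  by_cases hE : e ∈ (zdGraph 2).edgeSet
  · obtain ⟨u, i, rfl⟩ := mem_edgeSet_zdGraph_iff.1 hE
    have hu : u ∈ zDualBall x n := by
      fin_cases i
      · simp only [Fin.zero_eta] at he
        rw [dualEdge_horizontal] at he
        exact he u (Sym2.mem_mk_right _ _)
      · simp only [Fin.mk_one] at he
        rw [dualEdge_vertical] at he
        exact he u (Sym2.mem_mk_right _ _)
    rw [mem_zDualBall_iff] at hu
    simp only [abs_le] at hu
    intro v hv
    rw [mem_zBall_iff]
    simp only [abs_le, Nat.cast_add, Nat.cast_one]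
    rcases Sym2.mem_iff.1 hv with rfl | rfl
    · omega
    · fin_cases i
      · simp only [Fin.zero_eta, Fin.isValue, Pi.add_apply, Pi.single_eq_same, ne_eq, one_ne_zero,
          not_false_eq_true, Pi.single_eq_of_ne, add_zero]
        omega
      · simp only [Fin.mk_one, Fin.isValue, Pi.add_apply, ne_eq, zero_ne_one, not_false_eq_true,
          Pi.single_eq_of_ne, add_zero, Pi.single_eq_same]
        omega
  · rw [dualEdge_of_not_mem hE] at he
    exact fun v hv ↦ zDualBall_subset_zBall_succ x n (he v hv)

/-- **Outward locality of the pinch event** (registered helper, stub S3): `ZPinch x y m n` is determined by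
the pairs inside the box `Λ_{2n+1}(x)`. -/
theorem zPinch_determinedBy_zIntEdges : ∀ (x y : Site 2) (m n : ℕ), DeterminedBy (ZPinch x y m n) (zIntEdges x (2 * n + 1)) := by
  intro x y m n
  refine (zPinch_determinedBy x y m n).mono ?_
  rintro e (he | he)
  · intro v hv
    exact zBall_subset_zBall (y := x) (s := 2 * n) (n := 2 * n + 1)
      (by rw [sub_self]; simp [zNorm]) ((Set.mem_sym2_iff_subset.1 he) hv).1
  · exact mem_zBall_succ_of_mem_dualEdge fun u hu ↦ ((Set.mem_sym2_iff_subset.1 he) hu).1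

/-- Outward locality of the primal hook-up: `ZHook x y m n` is determined by the pairs inside `Λ_{2n}(x)`. -/
theorem zHook_determinedBy_zIntEdges (x y : Site 2) (m n : ℕ) :
    DeterminedBy (ZHook x y m n) (zIntEdges x (2 * n)) := by
  rw [zIntEdges_eq_sym2]
  exact zHook_determinedBy x y m n

/-- Disjoint boxes have disjoint interior pair sets. -/
theorem disjoint_zIntEdges {x x' : Site 2} {k k' : ℕ} (h : Disjoint (zBall x k) (zBall x' k')) :
    Disjoint (zIntEdges x k) (zIntEdges x' k') := by
  refine Set.disjoint_left.2 fun e he he' ↦ ?_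
  have h₁ : ∀ v ∈ e, v ∈ zBall x k := he
  have h₂ : ∀ v ∈ e, v ∈ zBall x' k' := he'
  exact Set.disjoint_left.1 h (h₁ _ (Sym2.out_fst_mem e)) (h₂ _ (Sym2.out_fst_mem e))

/-- **Pinch events in disjoint boxes are independent**, even cut down by arbitrary measurable local events
`A`, `A'` of their boxes `Λ_{2n+1}(x)`, `Λ_{2n'+1}(x')`:
`P((Pinch ∩ A) ∩ (Pinch' ∩ A')) = P(Pinch ∩ A) · P(Pinch' ∩ A')` under `P = P_{1/2}` on `ℤ²`. -/
theorem real_zPinch_inter_zPinch {x y x' y' : Site 2} {m n m' n' : ℕ}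
    (h : Disjoint (zBall x (2 * n + 1)) (zBall x' (2 * n' + 1))) {A A' : Set (BondConfig (Site 2))}
    (hAm : MeasurableSet A) (hA : DeterminedBy A (zIntEdges x (2 * n + 1)))
    (hA'm : MeasurableSet A') (hA' : DeterminedBy A' (zIntEdges x' (2 * n' + 1))) :
    (bondPercolation (zdGraph 2) half).real ((ZPinch x y m n ∩ A) ∩ (ZPinch x' y' m' n' ∩ A')) =
      (bondPercolation (zdGraph 2) half).real (ZPinch x y m n ∩ A) *
        (bondPercolation (zdGraph 2) half).real (ZPinch x' y' m' n' ∩ A') :=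
  bondPercolation_real_inter_of_disjoint (zdGraph 2) half (disjoint_zIntEdges h)
    ((zPinch_determinedBy_zIntEdges x y m n).inter hA) ((zPinch_determinedBy_zIntEdges x' y' m' n').inter hA')
    ((measurableSet_zPinch x y m n).inter hAm) ((measurableSet_zPinch x' y' m' n').inter hA'm)

end Summit.CriticalPhenomena.CardyFormulaZ2.Cruxes.NestingRigidity.PinchResampling

end
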